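/-
Origin: expansion seat `planner-pub-hodgecm-mc-axioms-1-g14-0`, handover #W126 2026-08-20T15:53:55Z md5 d71e932adfeb (PKG 12a2d331bb1a → d71e932adfeb; 149 l.; MECHANICAL (iib-R) rewrite v3.1 of the PKG file as it stands (41 token edits; rules R1x1+R2x12+RX[h₂']x12+R3x3+R8x13)) (`HOME/mc/pub-hodgecm-mc-axioms-1-g14/revendor/kit-r55/stage55/HodgeCM/Model/ClassMapTranslate.lean`, md5 d71e932adfeb, 149 lines);
landed by the gen-22 packager (p-g22) in gate run 55 REPLACES the earlier landed copy of `HodgeCM/Model/ClassMapTranslate.lean` (seat copy carried the packager Origin header of an earlier run (stripped)).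
-/
/-
Unit pub-hodgecm-mc-autform-2-g4 (node D1-aut CLASSMAP, N33b half). NEW additive leaf `HodgeCM/Model/ClassMapTranslate.lean`.
The `transl`-shaped dictionary for the class-map data `D_Γ = Model.classMapDatumOf …` of the model universe: a theta
class of level `Γ` has a γ-TRANSLATED theta class of level `Γ'` (holomorphic lift = pull-back one-form by `γ`) as soon
as the theta-form spaces upstairs are stable under the finite-adelic right translate attached to the rational `γ`
(no holomorphy hypothesis: the translate of a holomorphic lift is holomorphic, tree `UnitaryBallHolomorphicTranslate`). KERNEL: re-export of the vendored tree leaf `UnitaryBallClassMapTranslate`;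
0 hypotheses asserted, 0 records; expected `#print axioms`: {propext, Classical.choice, Quot.sound}.
-/
import Summits.HodgeConjecture.HodgeCM.Model.ClassMapInstance
import Literature.AlgebraicGeometry.ShimuraVarieties.UnitaryBallClassMapTranslate

/-!
# Hecke translates of theta classes in the model universe (node D1-aut CLASSMAP, N33b)

For `U := picardCMUniverse hHD hI h₁ hU h₃`, two levels `Γ Γ' : Level V` (anisotropic regime, frames
`𝔣`, `𝔣'`), one archimedean situation `ιinf : U(2,1) →* GU` read at the two levels, theta-form spaces
`Θ` (level `Γ`) and `Θ'` (level `Γ'`) upstairs, and `γ ∈ U(2,1)`: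

* `Model.exists_mem_thetaClasses_classLift_eq_of_rightTranslate` — if `γ` is RATIONAL
  (`ιinf γ · k ∈ ΓU`, `k` commuting with `ιinf (U(2,1))`) and for each `F ∈ Θ` the space `Θ'` contains a
  form `F'` with `F'(g) = F(g k⁻¹)`, then every
  `ω ∈ thetaClasses ιinf D_Γ Θ` has `ω' ∈ thetaClasses ιinf D_Γ' Θ'` with
  `classLift_{Γ'} ω' = fun z ↦ (Jac γ z)ᵀ *ᵥ classLift_Γ ω (γ • z)`;
* `Model.exists_mem_thetaClasses_classLift_eq_of_rightTranslateHom` — the same with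
  `F' := ThetaKernelDatum.rightTranslateHom κ κ' η k⁻¹ hh hτ F`, leaving exactly: rationality data of
  `γ` and stability `R(k⁻¹) Θ ⊆ Θ'`;
* `Model.exists_mem_thetaClasses_classLift_eq_translate_of_apply_eq` — the hypothesis directly on adelic
  functions: each `F ∈ Θ` has `F' ∈ Θ'` with `F'(ιinf g) = F(ιinf (γ g))`.

With the R6 pin `Theta V c i Γ := thetaClasses ιinf (D Γ) (Θ i Γ)`, `D Γ := classMapDatumOf … Γ …` and
`ev Γ := classLift` (the ball data of the period lane), the conclusion is the body of the ball-facts field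
`transl` (`∃ Γ' ω', ω' ∈ Theta V c i Γ' ∧ ev Γ' ω' = fun x ↦ J γ x *ᵥ ev Γ ω (γ • x)`, `J γ x = (Jac γ x)ᵀ`).
-/

noncomputable section

open scoped Matrix TensorProduct
open MulAction NumberField
open Literature.Geometry.ComplexHyperbolic.BallModel (U21 Ball Jac x₀)
open Literature.NumberTheory.Automorphic
open Literature.NumberTheory.Automorphic.AutomorphyFactor
open Literature.AlgebraicGeometry.HodgeTheory
open Literature.AlgebraicGeometry.ShimuraVarieties

namespace HodgeCM

namespace Model

open Literature.NumberTheory.Automorphic.PicardCM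

section EndState

variable (hHD : exists_isReal_hodgeModel) (hI : hodgePQ_independent_of_hodgeModel)
  (h₁ : BallQuotientUniformised)  (h₃ : CMAbelianVarietyRealised)

variable {GU : Type*} [Group GU] {Kc Kc' : Type*} [Group Kc] [Group Kc']
variable {ΓU ΓU' : Subgroup GU} {κ : Kc →* GU} {κ' : Kc' →* GU}
variable {τ : Representation ℂ Kc (Fin 2 → ℂ)} {τ' : Representation ℂ Kc' (Fin 2 → ℂ)}

variable {L : CMField} {ι₁ : L →+* ℂ} {V : HermSpace3 L ι₁} (Γ Γ' : Level V)
  (h h' : IsAnisotropic L V.Hm)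
  (𝔣 : (ballDatumOf (hHD := hHD) (hI := hI) (hU := ballQuotientUniformisedDatum_of h₁) (h₃ := h₃)
    L ι₁ V Γ h).SylvesterFrame)
  (𝔣' : (ballDatumOf (hHD := hHD) (hI := hI) (hU := ballQuotientUniformisedDatum_of h₁) (h₃ := h₃)
    L ι₁ V Γ' h').SylvesterFrame)
  (ιinf : U21 →* GU) {η₁ : stabilizer U21 x₀ →* Kc} {η₁' : stabilizer U21 x₀ →* Kc'}
  (hΔ : WeightForms.IsLevelCorrected ΓU κ τ ιinf
    ((ballDatumOf (hHD := hHD) (hI := hI) (hU := ballQuotientUniformisedDatum_of h₁) (h₃ := h₃)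
      L ι₁ V Γ h).ballImage 𝔣))
  (hη : WeightForms.IsWeightMatched κ τ ιinf (stabilizer U21 x₀).subtype
    (BallForms.isPullbackCocycle_cotangentCocycle.weightOf x₀) η₁)
  (hη' : WeightForms.IsWeightMatched κ' τ' ιinf (stabilizer U21 x₀).subtype
    (BallForms.isPullbackCocycle_cotangentCocycle.weightOf x₀) η₁')

/-- **Translated theta classes, hypothesis on the adelic group.** For `γ` rational (`ιinf γ · k ∈ ΓU`,
`k` commuting with `ιinf (U(2,1))`): if for each `F ∈ Θ` the space `Θ'` of level `Γ'` contains a form `F'`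
with `F'(g) = F(g k⁻¹)`, every theta class of `(D_Γ, Θ)` has a theta class of `(D_Γ', Θ')` whose
holomorphic lift is the pull-back one-form by `γ`. -/
theorem exists_mem_thetaClasses_classLift_eq_of_rightTranslate
    (hΔ' : WeightForms.IsLevelCorrected ΓU' κ' τ' ιinf
      ((ballDatumOf (hHD := hHD) (hI := hI) (hU := ballQuotientUniformisedDatum_of h₁) (h₃ := h₃)
        L ι₁ V Γ' h').ballImage 𝔣'))
    (Θ : Submodule ℂ (weightForms ΓU κ τ)) (Θ' : Submodule ℂ (weightForms ΓU' κ' τ'))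
    {γ : U21} {k : GU} (hγk : ιinf γ * k ∈ ΓU) (hk : ∀ x : U21, Commute k (ιinf x))
    {ω : (picardCMUniverse hHD hI h₁ h₃).CohC ((picardCMUniverse hHD hI h₁ h₃).pms L ι₁ V Γ) 1}
    (hω : ω ∈ WeightForms.thetaClasses ιinf (classMapDatumOf hHD hI h₁ h₃ Γ h 𝔣 ιinf hΔ hη) Θ)
    (hΘ : ∀ F ∈ Θ, ∃ F' ∈ Θ', ∀ g : GU, (F' : GU → Fin 2 → ℂ) g = (F : GU → Fin 2 → ℂ) (g * k⁻¹)) :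
    ∃ ω' ∈ WeightForms.thetaClasses ιinf (classMapDatumOf hHD hI h₁ h₃ Γ' h' 𝔣' ιinf hΔ' hη') Θ',
      (ballDatumOf (hHD := hHD) (hI := hI) (hU := ballQuotientUniformisedDatum_of h₁) (h₃ := h₃)
          L ι₁ V Γ' h').classLift hHD 𝔣' ω' =
        fun z ↦ (Jac γ z)ᵀ *ᵥ
          (ballDatumOf (hHD := hHD) (hI := hI) (hU := ballQuotientUniformisedDatum_of h₁) (h₃ := h₃)
            L ι₁ V Γ h).classLift hHD 𝔣 ω (γ • z) :=
  UnitaryBallUniformisationDatum.exists_mem_thetaClasses_classLift_eq_of_rightTranslate _ _ hHD 𝔣 𝔣' hI ιinf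
    hΔ hη hη' hΔ' Θ Θ' hγk hk hω hΘ

/-- **Translated theta classes, Hecke-translate version**: with `F' := rightTranslateHom κ κ' η k⁻¹ hh hτ F`
the remaining inputs are rationality data of `γ` and stability `R(k⁻¹) Θ ⊆ Θ'`. -/
theorem exists_mem_thetaClasses_classLift_eq_of_rightTranslateHom {η : Kc' →* Kc}
    (hΔ' : WeightForms.IsLevelCorrected ΓU κ' τ' ιinf
      ((ballDatumOf (hHD := hHD) (hI := hI) (hU := ballQuotientUniformisedDatum_of h₁) (h₃ := h₃)
        L ι₁ V Γ' h').ballImage 𝔣'))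
    (Θ : Submodule ℂ (weightForms ΓU κ τ)) (Θ' : Submodule ℂ (weightForms ΓU κ' τ'))
    {γ : U21} {k : GU} (hγk : ιinf γ * k ∈ ΓU) (hk : ∀ x : U21, Commute k (ιinf x))
    (hh : ∀ k' : Kc', κ' k' * k⁻¹ = k⁻¹ * κ (η k')) (hτ : ∀ k' : Kc', τ' k' = τ (η k'))
    {ω : (picardCMUniverse hHD hI h₁ h₃).CohC ((picardCMUniverse hHD hI h₁ h₃).pms L ι₁ V Γ) 1}
    (hω : ω ∈ WeightForms.thetaClasses ιinf (classMapDatumOf hHD hI h₁ h₃ Γ h 𝔣 ιinf hΔ hη) Θ)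
    (hΘ : ∀ F ∈ Θ,
      Literature.NumberTheory.Weil1964.ThetaKernelDatum.rightTranslateHom κ κ' η k⁻¹ hh hτ F ∈ Θ') :
    ∃ ω' ∈ WeightForms.thetaClasses ιinf (classMapDatumOf hHD hI h₁ h₃ Γ' h' 𝔣' ιinf hΔ' hη') Θ',
      (ballDatumOf (hHD := hHD) (hI := hI) (hU := ballQuotientUniformisedDatum_of h₁) (h₃ := h₃)
          L ι₁ V Γ' h').classLift hHD 𝔣' ω' =
        fun z ↦ (Jac γ z)ᵀ *ᵥ
          (ballDatumOf (hHD := hHD) (hI := hI) (hU := ballQuotientUniformisedDatum_of h₁) (h₃ := h₃)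
            L ι₁ V Γ h).classLift hHD 𝔣 ω (γ • z) :=
  UnitaryBallUniformisationDatum.exists_mem_thetaClasses_classLift_eq_of_rightTranslateHom _ _ hHD 𝔣 𝔣' hI ιinf
    hΔ hη hη' Θ Θ' hΔ' hγk hk hh hτ hω hΘ

/-- **Translated theta classes, hypothesis on adelic functions**: each `F ∈ Θ` has a partner `F' ∈ Θ'`
with `F'(ιinf g) = F(ιinf (γ g))` for all `g ∈ U(2,1)` (two `K`-types / levels upstairs allowed). -/
theorem exists_mem_thetaClasses_classLift_eq_translate_of_apply_eq
    (hΔ' : WeightForms.IsLevelCorrected ΓU' κ' τ' ιinf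
      ((ballDatumOf (hHD := hHD) (hI := hI) (hU := ballQuotientUniformisedDatum_of h₁) (h₃ := h₃)
        L ι₁ V Γ' h').ballImage 𝔣'))
    (Θ : Submodule ℂ (weightForms ΓU κ τ)) (Θ' : Submodule ℂ (weightForms ΓU' κ' τ')) (γ : U21)
    {ω : (picardCMUniverse hHD hI h₁ h₃).CohC ((picardCMUniverse hHD hI h₁ h₃).pms L ι₁ V Γ) 1}
    (hω : ω ∈ WeightForms.thetaClasses ιinf (classMapDatumOf hHD hI h₁ h₃ Γ h 𝔣 ιinf hΔ hη) Θ)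
    (hΘ : ∀ F ∈ Θ, ∃ F' ∈ Θ', ∀ g : U21,
      (F' : GU → Fin 2 → ℂ) (ιinf g) = (F : GU → Fin 2 → ℂ) (ιinf (γ * g))) :
    ∃ ω' ∈ WeightForms.thetaClasses ιinf (classMapDatumOf hHD hI h₁ h₃ Γ' h' 𝔣' ιinf hΔ' hη') Θ',
      (ballDatumOf (hHD := hHD) (hI := hI) (hU := ballQuotientUniformisedDatum_of h₁) (h₃ := h₃)
          L ι₁ V Γ' h').classLift hHD 𝔣' ω' =
        fun z ↦ (Jac γ z)ᵀ *ᵥ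
          (ballDatumOf (hHD := hHD) (hI := hI) (hU := ballQuotientUniformisedDatum_of h₁) (h₃ := h₃)
            L ι₁ V Γ h).classLift hHD 𝔣 ω (γ • z) :=
  UnitaryBallUniformisationDatum.exists_mem_thetaClasses_classLift_eq_translate_of_apply_eq _ _ hHD 𝔣 𝔣' hI
    ιinf hΔ hη hη' hΔ' Θ Θ' γ hω hΘ

end EndState

end Model

end HodgeCM

end
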